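import Literature.AlgebraicGeometry.HodgeTheory.CycleClassPrincipalDivisorProjectiveSpaceHolds
import Literature.AlgebraicGeometry.HodgeTheory.ComplexOrientationCycleClassFacts
import HarnessLib

/-!
# The rational `(d,d)`-classes of a `(d+1)`-fold are spanned by pull-backs from `ℙ^{d+1}` (named fact), and Voisin's Lemma 9.18 for the complex orientations from it and the degree formula

Family `hodge`, layer `Literature/AlgebraicGeometry/HodgeTheory`. One NAMED FACT (D-0014) and its
consequence for the trust base of the route `HodgeConjecture/LimitExtension`.

The fact `topHodgeClasses_spanned_by_pullbacks`: for `T` smooth projective over `ℂ` of dimension `d + 1`,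
every rational class `a ∈ H^{2d}(T(ℂ); ℂ)` of Hodge type `(d,d)` is a `ℂ`-linear combination of classes
`F^* u` with `F : T ⟶ ℙ^{d+1}_ℂ` a morphism and `u ∈ H^{2d}(ℙ^{d+1}(ℂ); ℂ)` — the hypothesis predicate
`TopHodgeClassesSpannedByPullbacks d T` of `HodgeTheory/CycleClassPrincipalDivisorOfProjectiveSpace` for
every such `T`. This is the conjunction of three printed theorems and two elementary remarks:

1. hard Lefschetz (C. Voisin, *Hodge Theory and Complex Algebraic Geometry I*, Thm. 6.25:
   "`L^{n-k} : H^k(X, ℝ) → H^{2n-k}(X, ℝ)` is an isomorphism"; with `n = d + 1`, `k = 2`, and `L` the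
   operator of a hyperplane class `h`, defined over `ℚ` and of bidegree `(1,1)`): every rational
   `(d,d)`-class is `h^{d-1} ∪ y` with `y` a rational `(1,1)`-class;
2. the Lefschetz theorem on `(1,1)`-classes (Voisin I, Thm. 11.30: "`Hdg²(X, ℤ)` is equal to the image of
   `c₁ : Pic X → H²(X, ℤ)`", with Cor. 11.34 for projective `X`): `y` is a `ℚ`-combination of first Chern
   classes of line bundles, i.e. (every divisor being a difference of two very ample ones, R. Hartshorne,
   *Algebraic Geometry*, II Thm. 7.6 with II Ex. 7.5) of classes `G^* h_N = c₁(G^* 𝒪(1))`, `G : T ⟶ ℙ^N`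
   (Voisin I, Thm. 7.10 / Prop. 11.? functoriality of `c₁`; Griffiths–Harris, Ch. 1 §1);
3. polarisation: a monomial `z₁ ∪ ⋯ ∪ z_d` in classes `zᵢ = Gᵢ^* h` is a `ℚ`-combination of `d`-th powers
   `(G^* h)^d = G^*(h^d)` of such classes (sums of such classes are again such, through Segre embeddings),
   and for `G : T ⟶ ℙ^N` a generic linear projection `ℙ^N ⇢ ℙ^{d+1}`, regular on `G(T)` (`dim T = d + 1`),
   gives `F : T ⟶ ℙ^{d+1}` with `F^* h = G^* h` (Hartshorne I Ex. 3.14, II Example 7.1.1;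
   Griffiths–Harris Ch. 1 §3).

Hard Lefschetz and the rational Lefschetz `(1,1)` theorem (in support form, `lefschetzOneOne_rational`)
are THEOREMS of the tree; what the tree lacks for a proof of the fact is the first Chern class of an
algebraic line bundle on the summit carriers with its functoriality and additivity, the very-ample
generation of the Néron–Severi group, and the pull-back of the hyperplane class along linear projections.
Nothing is asserted: users take `(hS : topHodgeClasses_spanned_by_pullbacks)`.

Consequence (`Voisin2003_cycleClass_div_eq_zero_complexOrientation_of_degreeFormula_of_spanning`):
**Voisin's Lemma 9.18 for the complex orientations** (the named fact
`Voisin2003_cycleClass_div_eq_zero_complexOrientation` of `ComplexOrientationCycleClassFacts`) **follows from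
Fulton's degree formula** (`Fulton1998_degreeFormula_complexOrientation`) **and this fact** — by the Hodge
index route of `CycleClassVanishingOfHodgePairing`, `CycleClassPrincipalDivisorOfProjectiveSpace`,
`CycleClassDivEqZeroOfSmooth`, `CycleClassPrincipalDivisorOffVertex`,
`CycleClassPrincipalDivisorProjectiveSpaceHolds` (all proved).

## References

* [VoisinHodgeI2002] C. Voisin, Hodge Theory and Complex Algebraic Geometry I, CUP 2002, Thm. 6.25,
  Thm. 7.10, Thm. 11.30, Cor. 11.34, §11.3.3.
* [Hartshorne1977] R. Hartshorne, Algebraic Geometry, GTM 52, I Ex. 3.14, II Example 7.1.1, II Thm. 7.6,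
  II Ex. 7.5.
* [GriffithsHarrisPrinciples1978] P. Griffiths, J. Harris, Principles of Algebraic Geometry, Wiley 1978,
  Ch. 1 §1 (Chern classes of line bundles, functoriality), Ch. 0 §7 and Ch. 1 §3.
* [VoisinHodgeII2003] C. Voisin, Hodge Theory and Complex Algebraic Geometry II, CUP 2003, Lemma 9.18.
* [Fulton1998] W. Fulton, Intersection Theory, 2nd ed. 1998, Lemma 19.1.2.
-/

noncomputable section

open CategoryTheory AlgebraicGeometry

namespace Literature.AlgebraicGeometry.HodgeTheory

section HodgeTheory

/-- NAMED FACT — **the rational `(d,d)`-classes of a smooth projective complex `(d+1)`-fold are spanned by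
pull-backs of classes of `ℙ^{d+1}`**: for `T` smooth projective of dimension `d + 1` over `ℂ`, every
rational class of Hodge type `(d,d)` in `H^{2d}(T(ℂ); ℂ)` is a `ℂ`-linear combination of classes `F^* u`,
`F : T ⟶ ℙ^{d+1}_ℂ` a morphism, `u ∈ H^{2d}(ℙ^{d+1}(ℂ); ℂ)` (the predicate `TopHodgeClassesSpannedByPullbacks`).
Hard Lefschetz (Voisin I, Thm. 6.25) writes such a class as `h^{d-1} ∪ y` with `y` rational of type
`(1,1)`; the Lefschetz theorem on `(1,1)`-classes (Voisin I, Thm. 11.30 with Cor. 11.34) writes `y` as a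
`ℚ`-combination of first Chern classes of line bundles, hence of very ample ones `G^* 𝒪(1)`
(Hartshorne II Thm. 7.6, Ex. 7.5), whose `c₁` is `G^* h`; polarisation and generic linear projections
`ℙ^N ⇢ ℙ^{d+1}` regular on `G(T)` turn the resulting monomials into combinations of `F^*(h^d)`,
`F : T ⟶ ℙ^{d+1}` (module docstring). [cite: VoisinHodgeI2002, Thm. 6.25, Thm. 11.30 and Cor. 11.34]
[cite: Hartshorne1977, II Thm. 7.6, II Ex. 7.5 and II Example 7.1.1]
[cite: GriffithsHarrisPrinciples1978, Ch. 1 §1] -/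
def topHodgeClasses_spanned_by_pullbacks : Prop :=
  ∀ ⦃d : ℕ⦄ ⦃T : Motives.SchemeOver ℂ⦄, Motives.IsSmoothProjective (d + 1) T →
    TopHodgeClassesSpannedByPullbacks d T

/-- **Voisin's Lemma 9.18 for the complex orientations from Fulton's degree formula and the spanning
fact.** The named fact `Voisin2003_cycleClass_div_eq_zero_complexOrientation` (`[div φ] = 0` in
`H^{2e}(X(ℂ); ℂ)` for every closed subvariety `W ⊆ X` of dimension `d + 1` of a smooth projective `X` and
every `φ ∈ K(W)ˣ`, for the complex orientation family) follows from `Fulton1998_degreeFormula_complexOrientation`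
and `topHodgeClasses_spanned_by_pullbacks`: desingularise `W`; on the model `T` the class `[div φ]` is
rational of type `(1,1)` and pairs to zero with every `F^* u`, `F : T ⟶ ℙ^{d+1}`, because
`⟨[div φ] ∪ F^*u, [T]⟩ = ⟨[div Nm φ] ∪ u, [ℙ^{d+1}]⟩` and Lemma 9.18 holds on `ℙ^{d+1}` (projection from the
vertex of the blow-up, Fulton Prop. 1.4); these `F^*u` span the rational `(d,d)`-classes (the fact), so
the class vanishes by the Hodge index theorem (`cycleClassDivEqZero_complexOrientationFamily_of_spanning`).
[cite: VoisinHodgeII2003, Lemma 9.18] [cite: Fulton1998, Lemma 19.1.2 and Prop. 1.4]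
[cite: VoisinHodgeI2002, Thm. 6.25 and Thm. 11.30] -/
theorem Voisin2003_cycleClass_div_eq_zero_complexOrientation_of_degreeFormula_of_spanning
    (hA : Fulton1998_degreeFormula_complexOrientation) (hS : topHodgeClasses_spanned_by_pullbacks) :
    Voisin2003_cycleClass_div_eq_zero_complexOrientation :=
  cycleClassDivEqZero_complexOrientationFamily_of_spanning hA fun _ _ hT ↦ hS hT

end HodgeTheory

end Literature.AlgebraicGeometry.HodgeTheory

end
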